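import Summits.Ventures.CertifiedManyBodySolver.Observables.StiffnessThermalOddMomentHook
import Summits.Ventures.CertifiedManyBodySolver.HubbardAlg.SdaSectorBlocks
import HarnessLib

/-!
# The thermal TRIAL-GENERATOR stiffness ceiling of the `t–t′` torus for ANY admissible local generator, and its
# local word (part 1 of 2; part 2 = `StiffnessThermalTrialGeneratorHook.lean`)

HONEST FRAMING: a one-sided CEILING on the thermal flux stiffness (helicity modulus) under certified inputs; KT ceilings
never assert superconductivity; NO lower bound on `T_c` is claimed; NO certificate and NO number lives in this file; no
summit, rung or crux statement is proved here. Cell `pub/hubbard-tc` × sub-crew `speedrun/mbsolver/hubbard-thermal`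
(D-0154 (1) block (D) «THERMAL CERTIFICATES»), seat `hubbard-thermal-p4` (typist: certificate objects + reader theorems).

`StiffnessThermalOddMomentCeiling/Hook` (hubbard-tc-mod-2) compose pub-hubbard's sharp Bogoliubov–Duhamel trial-operator
ceiling `thermalStiffnessTT'_le_kin_sub_trialOperator` (every Hermitian `C` on the sector space) with the ONE Krylov trial
operator `C = i[H, 𝒥]`. Here `C` is the translation sum `C_a = Σ_v T_v Γa` of an ARBITRARY admissible local generator
`a ∈ 𝔄_{[-r,r]²}` (Hermitian, even, conserving `N` and `S^z`) — the all-generators form asked for by the crux-plan line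
«trialgen_b10» of route «hubbard-tc-thermcert-1» (its STUB 1 `TrialGeneratorHook`, shared by the K1 anchor and the K2-box
skeleton). With `k₀ = kinBondObsTT t′`, `j₀ = curBondObsTT t′`, `commDensity` the local commutator density of
`FermionTorusTranslationSums`, `d_a = Σ_{z∈[-(r+1),r+1]²} [τ_z j₀, a]`, `h_a = [H_{[-(r+1),r+1]²}, Γa]`,
`m_a = Σ_{z∈[-(2r+1),2r+1]²} [τ_z a, h_a]`, the bound is ONE LINEAR LOCAL WORD `W_a = ½Γk₀ + i·Γd_a + ½m_a` on `[-(3r+2), 3r+2]²`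
(term for term the `trialWord t′ U r a` of the line file; the scale of `a` is the variational parameter):

* §0 admissibility: `[a, N] = [a, S^z] = 0 ⇒ PreservesSectors a`; torus translates and the translation sum `C_a` of a
  sector-conserving local observable conserve `(N↑, N↓)`; `C_a` is Hermitian.
* §1 locality (`FermionTorusTranslationSums`): `⟨ψ, [𝒥, C_a] ψ⟩ = L²·torusAvg(d_a)(ψ)`, `[H, C_a] = Σ_v T_v Γ(h_a)`,
  `⟨ψ, [C_a, [H, C_a]] ψ⟩ = L²·torusAvg(m_a)(ψ)` for every torus vector `ψ`.
* §2 `thermalStiffness_le_re_sectorGibbsAvg_trialGeneratorWord` — finite volume in hubbard-thermal's mixture vocabulary: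
  at every side `L ≥ 6r+5`, for every `ρ_s` admissible for the flux-twisted canonical-sector log-partition function at `β`,
  `ρ_s ≤ Re Σ_i p_{L,i}(β)·torusAvg_{[-(3r+2),3r+2]²}(W_a)(ψ_{L,i})` (engine at `μ = 1`, `−‖⟨[C,J]⟩‖ ≤ Re(i⟨[J,C]⟩)`, blocks of
  products = products of blocks, §1).

WHAT THIS IS NOT: no thermal certificate of any word `W_a` exists today; the trial-generator (polarisation) class never sees
the energy-diagonal (Drude-type) part of the current response.

References: DLS1978 §2 eqs. (22′), (27), (28); Lipparini2008 eq. (8.30); BratteliRobinsonII1997 §5.2.2, §6.2.1, Thm. 6.2.4;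
ScalapinoWhiteZhang1993 §II; Israel1979 §I.3 eq. (26); LiebPRL1989 Remark (2); Tasaki2020 §9.3.
-/
noncomputable section

namespace Summit.Ventures.CertifiedManyBodySolver.Observables

open Filter Topology Matrix Finset
open Literature.MathematicalPhysics.QuantumLattice
open Literature.MathematicalPhysics.QuantumLattice.ThermodynamicLimit
open Literature.MathematicalPhysics.QuantumFieldTheory
open Literature.MathematicalPhysics.StatisticalMechanics
open Literature.MathematicalPhysics.StatisticalMechanics.KosterlitzThouless
open Literature.Probability.LatticeModels
open scoped ComplexConjugate ComplexOrder

/-! ## §0 Admissible generators: sector conservation and Hermiticity of the translation sum -/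

section Admissible

/-- An operator commuting with `N = Σ_{x,σ} n_{xσ}` and `S^z = ½Σ_x (n_{x↑} − n_{x↓})` conserves `(N↑, N↓)`
(`N_↑ = ½N + S^z`, `N_↓ = ½N − S^z`). [cite: Tasaki2020, §9.3] [cite: LiebPRL1989, Remark (2)] -/
theorem preservesSectors_of_commute_totalNumber_spinZ {Λ : Type*} [LinearOrder Λ] [Fintype Λ]
    {M : Matrix (Finset (Orb Λ)) (Finset (Orb Λ)) ℂ} (hN : Commute M totalNumber) (hS : Commute M HubbardWave0.spinZ) :
    PreservesSectors M := by
  have hsum : ∀ σ : Fin 2, ∀ s s' : Finset (Orb Λ),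
      (∑ x : Λ, (numberOp x σ : Matrix (Finset (Orb Λ)) (Finset (Orb Λ)) ℂ)) s s' = ∑ x : Λ, (numberOp x σ) s s' :=
    fun σ s s' => Matrix.sum_apply _ _ _ _
  have hup : (∑ x : Λ, (numberOp x 0 : Matrix (Finset (Orb Λ)) (Finset (Orb Λ)) ℂ)) =
      (1 / 2 : ℂ) • totalNumber + HubbardWave0.spinZ := by
    ext s s'
    simp only [totalNumber, HubbardWave0.spinZ, Matrix.add_apply, Matrix.smul_apply, Matrix.sum_apply, Matrix.sub_apply,
      Fin.sum_univ_two, smul_eq_mul]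
    rw [Finset.sum_add_distrib, Finset.sum_sub_distrib]
    ring
  have hdown : (∑ x : Λ, (numberOp x 1 : Matrix (Finset (Orb Λ)) (Finset (Orb Λ)) ℂ)) =
      (1 / 2 : ℂ) • totalNumber - HubbardWave0.spinZ := by
    ext s s'
    simp only [totalNumber, HubbardWave0.spinZ, Matrix.sub_apply, Matrix.add_apply, Matrix.smul_apply, Matrix.sum_apply,
      Fin.sum_univ_two, smul_eq_mul]
    rw [Finset.sum_add_distrib, Finset.sum_sub_distrib]
    ring
  refine Summit.Ventures.CertifiedManyBodySolver.HubbardAlg.SdaDualEdge.preservesSectors_of_commute ?_ ?_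
  · rw [hup]; exact (hN.smul_right _).add_right hS
  · rw [hdown]; exact (hN.smul_right _).sub_right hS

variable {L : ℕ} [NeZero L]

/-- **Torus translates of an embedded sector-conserving local observable conserve `(N↑, N↓)`** (a translate is the embedding
of the shifted copy, `fermionEmbed_toTorusEmb_shiftEmb`, and `Γ(φ)` preserves sector conservation). [cite: LiebPRL1989, Remark (2)] -/
theorem preservesSectors_relabel_translate_fermionEmbed {Λ : Finset (Site 2)} (hΛ : Set.InjOn (Torus.proj (d := 2) L) ↑Λ)
    {a : FermionOp Λ} (ha : PreservesSectors a) (v : TorusSite 2 L) :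
    PreservesSectors (relabel (Orb.translate v) (fermionEmbed (PolySite.toTorusEmb L hΛ) a)) := by
  obtain ⟨z, rfl⟩ : ∃ z : Site 2, Torus.proj L z = v := ⟨Torus.cRep v, Torus.proj_cRep v⟩
  have h' : Set.InjOn (Torus.proj (d := 2) L) ↑(shiftSet z Λ) := (injOn_proj_shiftSet_iff L z Λ).2 hΛ
  rw [← fermionEmbed_toTorusEmb_shiftEmb L z hΛ h' a]
  exact Summit.Ventures.CertifiedManyBodySolver.HubbardAlg.SdaDualEdge.preservesSectors_fermionEmbed _
    (Summit.Ventures.CertifiedManyBodySolver.HubbardAlg.SdaDualEdge.preservesSectors_fermionEmbed _ ha)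

/-- **The translation sum `C_a = Σ_v T_v Γa` of a sector-conserving local observable conserves `(N↑, N↓)`**, hence acts in
the canonical `(N, S^z)` sectors. [cite: LiebPRL1989, Remark (2)] -/
theorem preservesSectors_sum_relabel_translate_fermionEmbed {Λ : Finset (Site 2)}
    (hΛ : Set.InjOn (Torus.proj (d := 2) L) ↑Λ) {a : FermionOp Λ} (ha : PreservesSectors a) :
    PreservesSectors (∑ v : TorusSite 2 L, relabel (Orb.translate v) (fermionEmbed (PolySite.toTorusEmb L hΛ) a)) :=
  PreservesSectors.sum fun v _ => preservesSectors_relabel_translate_fermionEmbed hΛ ha v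

/-- The translation sum of an embedded Hermitian local observable is Hermitian (`Γ` and `T_v` are `*`-maps).
[cite: BratteliRobinsonII1997, §5.2.2 Thm. 5.2.5] -/
theorem isHermitian_sum_relabel_translate_fermionEmbed {Λ : Finset (Site 2)}
    (hΛ : Set.InjOn (Torus.proj (d := 2) L) ↑Λ) {a : FermionOp Λ} (ha : a.IsHermitian) :
    (∑ v : TorusSite 2 L, relabel (Orb.translate v) (fermionEmbed (PolySite.toTorusEmb L hΛ) a)).IsHermitian := by
  have h1 : (fermionEmbed (PolySite.toTorusEmb L hΛ) a).IsHermitian := by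
    change (fermionEmbed (PolySite.toTorusEmb L hΛ) a)ᴴ = fermionEmbed (PolySite.toTorusEmb L hΛ) a
    rw [← fermionEmbed_conjTranspose, ha.eq]
  change (∑ v : TorusSite 2 L, relabel (Orb.translate v) (fermionEmbed (PolySite.toTorusEmb L hΛ) a))ᴴ = _
  rw [Matrix.conjTranspose_sum]
  exact Finset.sum_congr rfl fun v _ => by rw [← relabel_conjTranspose, h1.eq]

end Admissible

/-! ## §1 Locality: the two commutator moments are `L²` × torus averages of LOCAL words -/

section Locality

variable {L : ℕ} [NeZero L]

/-- **`[𝒥, C_a]` is local**: for every vector `ψ` of the `t–t′` torus (`2r + 4 < L`) and every local `a ∈ 𝔄_{[-r,r]²}`,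
`⟨ψ, (𝒥C_a − C_a𝒥) ψ⟩ = L² · torusAvg_{[-(r+2),r+2]²}(d_a)(ψ)` with `d_a = Σ_{z∈[-(r+1),r+1]²} [τ_z j₀, a]`
(`commDensity`; `𝒥 = Σ_v T_v Γj₀`, `j₀ = curBondObsTT t′` even). [cite: BratteliRobinsonII1997, Thm. 6.2.4] -/
theorem expect_cur_comm_sum_translate_eq_sq_mul_torusAvg (tp : ℝ) {r : ℕ} (hL : 2 * r + 4 < L)
    (hr : Set.InjOn (Torus.proj (d := 2) L) ↑(box 2 r)) (a : FermionOp (box 2 r)) (ψ : Fock (Orb (FermionTorus 2 L))) :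
    expect (curOpTT' L tp * (∑ v : TorusSite 2 L, relabel (Orb.translate v) (fermionEmbed (PolySite.toTorusEmb L hr) a)) -
        (∑ v : TorusSite 2 L, relabel (Orb.translate v) (fermionEmbed (PolySite.toTorusEmb L hr) a)) * curOpTT' L tp) ψ =
      ((L : ℂ) ^ 2) * torusAvgExpectAt L (box 2 (r + 2))
        (commDensity (box 2 (r + 2)) (box 2 (r + 1)) (box_subset_box (by omega)) (curBondObsTT tp) a) ψ := by
  have hΩ : Set.InjOn (Torus.proj (d := 2) L) ↑(box 2 (r + 2)) := injOn_proj_box (by omega)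
  have hZ : Set.InjOn (Torus.proj (d := 2) L) ↑(box 2 (r + 1)) := injOn_proj_box (by omega)
  have h1 : box 2 1 ⊆ box 2 (r + 2) := box_subset_box (by omega)
  have hC : box 2 r ⊆ box 2 (r + 2) := box_subset_box (by omega)
  have h := expect_commutator_sum_relabel_translate L hΩ hZ h1 hC
    (fun z hz => (shiftSet_subset_box_add (subset_refl (box 2 1)) hz).trans (box_subset_box (by omega)))
    (fun a ha c hc => box_subset_box (by omega) (sub_mem_box_add ha hc)) (curBondObsTT_mem_carEvenSubalgebra tp) a ψ
  rw [← curOpTT'_eq_sum_translate L tp] at h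
  exact h

/-- **`[H, C_a]` is a translation sum of the embedded LOCAL commutator `h_a = [H_{[-(r+1),r+1]²}, Γa]`** (`2r + 4 < L`).
[cite: BratteliRobinsonII1997, Thm. 6.2.4] -/
theorem hubbardTorusTT'_commutator_sum_translate (tp U : ℝ) {r : ℕ} (hL : 2 * r + 4 < L)
    (hr : Set.InjOn (Torus.proj (d := 2) L) ↑(box 2 r)) (hr1 : Set.InjOn (Torus.proj (d := 2) L) ↑(box 2 (r + 1)))
    (a : FermionOp (box 2 r)) :
    hubbardTorusTT' L 1 tp U * (∑ v : TorusSite 2 L, relabel (Orb.translate v) (fermionEmbed (PolySite.toTorusEmb L hr) a)) -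
        (∑ v : TorusSite 2 L, relabel (Orb.translate v) (fermionEmbed (PolySite.toTorusEmb L hr) a)) * hubbardTorusTT' L 1 tp U =
      ∑ v : TorusSite 2 L, relabel (Orb.translate v) (fermionEmbed (PolySite.toTorusEmb L hr1)
        ((hubbardTTPrimeFermionInteraction 1 tp U).localHamiltonian (box 2 (r + 1)) *
            fermionEmbed (PolySite.incl (box_subset_box (by omega) : box 2 r ⊆ box 2 (r + 1))) a -
          fermionEmbed (PolySite.incl (box_subset_box (by omega) : box 2 r ⊆ box 2 (r + 1))) a *
            (hubbardTTPrimeFermionInteraction 1 tp U).localHamiltonian (box 2 (r + 1)))) := by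
  have hInj : Set.InjOn (Torus.proj (d := 2) L) ↑(thicken (box 2 (r + 1)) 1) := injOn_proj_thicken_box_one (by omega)
  have h01 : box 2 r ⊆ box 2 (r + 1) := box_subset_box (by omega)
  have hCa : (∑ v : TorusSite 2 L, relabel (Orb.translate v) (fermionEmbed (PolySite.toTorusEmb L hr) a)) =
      ∑ v : TorusSite 2 L, relabel (Orb.translate v)
        (fermionEmbed (PolySite.toTorusEmb L (hInj.mono (by exact_mod_cast subset_thicken (box 2 (r + 1)) 1)))
          (fermionEmbed (PolySite.incl h01) a)) := by
    refine Finset.sum_congr rfl fun v _ => ?_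
    rw [fermionEmbed_toTorusEmb_incl]
  rw [hCa, hubbardTorusTT'_commutator_sum_relabel_translate L 1 tp U h01 (thicken_box_one_subset 2 r) hInj a]

/-- **`[C_a, [H, C_a]]` is local**: for every vector `ψ` of the `t–t′` torus (`6r + 4 < L`) and every EVEN local
`a ∈ 𝔄_{[-r,r]²}`, `⟨ψ, (C_a(HC_a − C_aH) − (HC_a − C_aH)C_a) ψ⟩ = L² · torusAvg_{[-(3r+2),3r+2]²}(m_a)(ψ)`,
`m_a = Σ_{z∈[-(2r+1),2r+1]²} [τ_z a, h_a]`. [cite: BratteliRobinsonII1997, §6.2.1 and Thm. 6.2.4] [cite: DLS1978, §2 eq. (28)] -/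
theorem expect_sum_translate_doubleComm_eq_sq_mul_torusAvg (tp U : ℝ) {r : ℕ} (hL : 6 * r + 4 < L)
    (hr : Set.InjOn (Torus.proj (d := 2) L) ↑(box 2 r)) {a : FermionOp (box 2 r)}
    (hae : a ∈ carEvenSubalgebra (Finset.univ : Finset (Orb (PolySite (box 2 r))))) (ψ : Fock (Orb (FermionTorus 2 L))) :
    expect ((∑ v : TorusSite 2 L, relabel (Orb.translate v) (fermionEmbed (PolySite.toTorusEmb L hr) a)) *
          (hubbardTorusTT' L 1 tp U * (∑ v : TorusSite 2 L, relabel (Orb.translate v) (fermionEmbed (PolySite.toTorusEmb L hr) a)) -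
            (∑ v : TorusSite 2 L, relabel (Orb.translate v) (fermionEmbed (PolySite.toTorusEmb L hr) a)) * hubbardTorusTT' L 1 tp U) -
        (hubbardTorusTT' L 1 tp U * (∑ v : TorusSite 2 L, relabel (Orb.translate v) (fermionEmbed (PolySite.toTorusEmb L hr) a)) -
            (∑ v : TorusSite 2 L, relabel (Orb.translate v) (fermionEmbed (PolySite.toTorusEmb L hr) a)) * hubbardTorusTT' L 1 tp U) *
          (∑ v : TorusSite 2 L, relabel (Orb.translate v) (fermionEmbed (PolySite.toTorusEmb L hr) a))) ψ =
      ((L : ℂ) ^ 2) * torusAvgExpectAt L (box 2 (3 * r + 2))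
        (commDensity (box 2 (3 * r + 2)) (box 2 (2 * r + 1)) (box_subset_box (by omega)) a
          ((hubbardTTPrimeFermionInteraction 1 tp U).localHamiltonian (box 2 (r + 1)) *
              fermionEmbed (PolySite.incl (box_subset_box (by omega) : box 2 r ⊆ box 2 (r + 1))) a -
            fermionEmbed (PolySite.incl (box_subset_box (by omega) : box 2 r ⊆ box 2 (r + 1))) a *
              (hubbardTTPrimeFermionInteraction 1 tp U).localHamiltonian (box 2 (r + 1)))) ψ := by
  have hΩ : Set.InjOn (Torus.proj (d := 2) L) ↑(box 2 (3 * r + 2)) := injOn_proj_box (by omega)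
  have hZ : Set.InjOn (Torus.proj (d := 2) L) ↑(box 2 (2 * r + 1)) := injOn_proj_box (by omega)
  have hr1 : Set.InjOn (Torus.proj (d := 2) L) ↑(box 2 (r + 1)) := injOn_proj_box (by omega)
  have hA : box 2 r ⊆ box 2 (3 * r + 2) := box_subset_box (by omega)
  have hC : box 2 (r + 1) ⊆ box 2 (3 * r + 2) := box_subset_box (by omega)
  have h := expect_commutator_sum_relabel_translate L hΩ hZ hA hC
    (fun z hz => (shiftSet_subset_box_add (subset_refl (box 2 r)) hz).trans (box_subset_box (by omega)))
    (fun a ha c hc => box_subset_box (by omega) (sub_mem_box_add ha hc)) hae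
    ((hubbardTTPrimeFermionInteraction 1 tp U).localHamiltonian (box 2 (r + 1)) *
        fermionEmbed (PolySite.incl (box_subset_box (by omega) : box 2 r ⊆ box 2 (r + 1))) a -
      fermionEmbed (PolySite.incl (box_subset_box (by omega) : box 2 r ⊆ box 2 (r + 1))) a *
        (hubbardTTPrimeFermionInteraction 1 tp U).localHamiltonian (box 2 (r + 1))) ψ
  rw [← hubbardTorusTT'_commutator_sum_translate tp U (by omega) hr hr1 a] at h
  exact h

end Locality

/-! ## §2 Finite volume in hubbard-thermal's mixture vocabulary -/

section Mixture

/-- Scalar bookkeeping of §2 (kept abstract so that no large matrix expression is compared by the arithmetic tactics):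
the engine at `μ = 1` plus `−‖m‖ ≤ g_I`. [folklore] -/
private theorem le_of_engine_one {ρL gK A gI gM : ℝ} (hle : ρL ≤ gK / 2 - 1 * A + 1 ^ 2 / 2 * gM)
    (hnorm : -(1 * A) ≤ gI) : ρL ≤ gK / 2 + gI + 1 / 2 * gM := by
  nlinarith [hle, hnorm]

/-- Scalar bookkeeping of §2: collect the three `L²`-multiples and divide by `L² > 0`. [folklore] -/
private theorem le_word_of_mul_sq_le {ρ L2 SK SD SM : ℝ} (h : ρ * L2 ≤ L2 * SK / 2 + L2 * SD + 1 / 2 * (L2 * SM))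
    (hL : 0 < L2) : ρ ≤ 1 / 2 * SK + SD + 1 / 2 * SM := by
  have h' : ρ * L2 ≤ (1 / 2 * SK + SD + 1 / 2 * SM) * L2 := by nlinarith [h]
  exact le_of_mul_le_mul_right h' hL

/-- `−‖z‖ ≤ Re(i·(−z))`. [folklore] -/
private theorem neg_norm_le_re_I_mul_neg (z : ℂ) : -‖z‖ ≤ (Complex.I * -z).re := by
  have h1 : |(Complex.I * -z).re| ≤ ‖Complex.I * -z‖ := Complex.abs_re_le_norm _
  rw [norm_mul, Complex.norm_I, one_mul, norm_neg] at h1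
  linarith [neg_abs_le (Complex.I * -z).re]

variable {L : ℕ} [NeZero L]

/-- **Finite volume (every admissible local generator `a`)**: at every side `L ≥ 6r+5`, for every Hermitian EVEN local
`a ∈ 𝔄_{[-r,r]²}` conserving `(N↑, N↓)` and every `ρ_s` admissible for the flux-twisted canonical-sector log-partition
function at `β`, `ρ_s ≤ Re Σ_i p_{L,i}(β) · torusAvg_{[-(3r+2),3r+2]²}(½Γk₀ + i·Γd_a + ½m_a)(ψ_{L,i})`, `(p_{L,i}, ψ_{L,i})`
the eigen-mixture of the canonical `(rectN n L, S^z = 0)` Gibbs state of `hubbardTorusTT' L 1 t′ U` (`sectorGibbsWeightTT'`,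
`sectorGibbsVectorTT'`). Engine: `thermalStiffnessTT'_le_kin_sub_trialOperator` at `μ = 1` with the Hermitian trial operator
`C = (C_a)_p`, `−‖⟨[C,J]⟩‖ ≤ Re(i⟨[J,C]⟩)`, blocks of products = products of blocks, §1.
[cite: DLS1978, §2 eqs. (22'), (27), (28)] [cite: Lipparini2008, eq. (8.30)] -/
theorem thermalStiffness_le_re_sectorGibbsAvg_trialGeneratorWord {tp U n β : ℝ} (hβ : 0 < β) {r : ℕ} (hL : 6 * r + 5 ≤ L)
    {a : FermionOp (box 2 r)} (ha : a.IsHermitian)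
    (hae : a ∈ carEvenSubalgebra (Finset.univ : Finset (Orb (PolySite (box 2 r))))) (haS : PreservesSectors a)
    {ρs θ₀ : ℝ} (hθ₀ : 0 < θ₀)
    (hst : ∀ θ : ℝ, |θ| ≤ θ₀ →
      β * ρs * θ ^ 2 ≤ thermalFluxLogZ L tp U (1 - n) β 0 - thermalFluxLogZ L tp U (1 - n) β θ) :
    ρs ≤ (∑ i, (sectorGibbsWeightTT' β 1 tp U n L i : ℂ) *
        torusAvgExpectAt L (box 2 (3 * r + 2))
          (((1 / 2 : ℝ) : ℂ) • fermionEmbed (PolySite.incl (box_subset_box (by omega) : box 2 1 ⊆ box 2 (3 * r + 2)))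
              (kinBondObsTT tp) +
            Complex.I • fermionEmbed (PolySite.incl (box_subset_box (by omega) : box 2 (r + 2) ⊆ box 2 (3 * r + 2)))
              (commDensity (box 2 (r + 2)) (box 2 (r + 1)) (box_subset_box (by omega)) (curBondObsTT tp) a) +
            ((1 / 2 : ℝ) : ℂ) • commDensity (box 2 (3 * r + 2)) (box 2 (2 * r + 1)) (box_subset_box (by omega)) a
              ((hubbardTTPrimeFermionInteraction 1 tp U).localHamiltonian (box 2 (r + 1)) *
                  fermionEmbed (PolySite.incl (box_subset_box (by omega) : box 2 r ⊆ box 2 (r + 1))) a -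
                fermionEmbed (PolySite.incl (box_subset_box (by omega) : box 2 r ⊆ box 2 (r + 1))) a *
                  (hubbardTTPrimeFermionInteraction 1 tp U).localHamiltonian (box 2 (r + 1))))
          (sectorGibbsVectorTT' 1 tp U n L i)).re := by
  -- notation
  set p : Finset (Orb (FermionTorus 2 L)) → Prop := fun s =>
    s.card = 2 * ⌊(1 - (1 - n)) * (L : ℝ) ^ 2 / 2⌋₊ ∧
      2 * (s.filter fun i => (ofLex i).2 = 0).card = 2 * ⌊(1 - (1 - n)) * (L : ℝ) ^ 2 / 2⌋₊ with hpdef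
  have hr : Set.InjOn (Torus.proj (d := 2) L) ↑(box 2 r) := injOn_proj_box (by omega)
  set H := hubbardTorusTT' L 1 tp U with hHdef
  set J := curOpTT' L tp with hJdef
  set K := kinOpTT' L tp with hKdef
  set Ca := ∑ v : TorusSite 2 L, relabel (Orb.translate v) (fermionEmbed (PolySite.toTorusEmb L hr) a) with hCadef
  set dA : FermionOp (box 2 (r + 2)) :=
    commDensity (box 2 (r + 2)) (box 2 (r + 1)) (box_subset_box (by omega)) (curBondObsTT tp) a with hdAdef
  set mA : FermionOp (box 2 (3 * r + 2)) :=
    commDensity (box 2 (3 * r + 2)) (box 2 (2 * r + 1)) (box_subset_box (by omega)) a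
      ((hubbardTTPrimeFermionInteraction 1 tp U).localHamiltonian (box 2 (r + 1)) *
          fermionEmbed (PolySite.incl (box_subset_box (by omega) : box 2 r ⊆ box 2 (r + 1))) a -
        fermionEmbed (PolySite.incl (box_subset_box (by omega) : box 2 r ⊆ box 2 (r + 1))) a *
          (hubbardTTPrimeFermionInteraction 1 tp U).localHamiltonian (box 2 (r + 1))) with hmAdef
  have hL0 : (0 : ℝ) < (L : ℝ) := by exact_mod_cast (show 0 < L by omega)
  have hL2 : (0 : ℝ) < (L : ℝ) ^ 2 := by positivity
  -- admissibility of the trial operator `C = (C_a)_p`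
  have hCaH : Ca.IsHermitian := isHermitian_sum_relabel_translate_fermionEmbed hr ha
  have hPC : PreservesSectors Ca := preservesSectors_sum_relabel_translate_fermionEmbed hr haS
  have hPH : PreservesSectors H := preservesSectors_hubbardTorusTT' 1 tp U
  have hPJ : PreservesSectors J := preservesSectors_curOpTT' (L := L) tp
  have hp : ∀ s, p s ↔ (upPart s).card = halfRectN n L ∧ (downPart s).card = halfRectN n L :=
    sectorPred_iff_upPart_downPart n L
  -- the engine at `μ = 1`
  have hfin := Summit.HubbardSuperconductivity.HubbardLadder.Bounds.thermalStiffnessTT'_le_kin_sub_trialOperator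
    (L := L) (by omega) tp U hβ hθ₀ p (by intro θ hθ; simpa only [thermalFluxLogZ] using hst θ hθ)
    (C := Ca.toBlock p p) (hCaH.submatrix _)
  obtain ⟨hle1, -, -⟩ := hfin
  have hle : ρs * (L : ℝ) ^ 2 ≤ (gibbsState β (H.toBlock p p) (K.toBlock p p)).re / 2 -
      1 * ‖gibbsState β (H.toBlock p p) (Ca.toBlock p p * J.toBlock p p - J.toBlock p p * Ca.toBlock p p)‖ +
      1 ^ 2 / 2 * (gibbsState β (H.toBlock p p) (Ca.toBlock p p * (H.toBlock p p * Ca.toBlock p p - Ca.toBlock p p * H.toBlock p p) -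
        (H.toBlock p p * Ca.toBlock p p - Ca.toBlock p p * H.toBlock p p) * Ca.toBlock p p)).re := hle1 1
  -- `−‖⟨CJ − JC⟩‖ ≤ Re (i·⟨JC − CJ⟩)`
  have hnorm : -(1 * ‖gibbsState β (H.toBlock p p) (Ca.toBlock p p * J.toBlock p p - J.toBlock p p * Ca.toBlock p p)‖) ≤
      (gibbsState β (H.toBlock p p) ((Complex.I • (J * Ca - Ca * J)).toBlock p p)).re := by
    have hB : (J * Ca - Ca * J).toBlock p p = J.toBlock p p * Ca.toBlock p p - Ca.toBlock p p * J.toBlock p p := by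
      rw [toBlock_sub_self, toBlock_mul_of_toBlock_compl_eq_zero p J Ca (toBlock_compl_eq_zero_of_preservesSectors_torus hPJ p hp),
        toBlock_mul_of_toBlock_compl_eq_zero p Ca J (toBlock_compl_eq_zero_of_preservesSectors_torus hPC p hp)]
    have hsm : (Complex.I • (J * Ca - Ca * J)).toBlock p p = Complex.I • (J * Ca - Ca * J).toBlock p p := rfl
    rw [hsm, map_smul, hB, smul_eq_mul]
    have hneg : J.toBlock p p * Ca.toBlock p p - Ca.toBlock p p * J.toBlock p p =
        -(Ca.toBlock p p * J.toBlock p p - J.toBlock p p * Ca.toBlock p p) := by abel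
    rw [hneg, map_neg, one_mul]
    exact neg_norm_le_re_I_mul_neg _
  -- the double commutator block is the double commutator of the blocks
  have hDB : (Ca * (H * Ca - Ca * H) - (H * Ca - Ca * H) * Ca).toBlock p p =
      Ca.toBlock p p * (H.toBlock p p * Ca.toBlock p p - Ca.toBlock p p * H.toBlock p p) -
        (H.toBlock p p * Ca.toBlock p p - Ca.toBlock p p * H.toBlock p p) * Ca.toBlock p p :=
    toBlock_doubleComm_eq_of_preservesSectors hPH hPC p hp
  rw [← hDB] at hle
  have hle' : ρs * (L : ℝ) ^ 2 ≤ (gibbsState β (H.toBlock p p) (K.toBlock p p)).re / 2 +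
      (gibbsState β (H.toBlock p p) ((Complex.I • (J * Ca - Ca * J)).toBlock p p)).re +
      1 / 2 * (gibbsState β (H.toBlock p p) ((Ca * (H * Ca - Ca * H) - (H * Ca - Ca * H) * Ca).toBlock p p)).re :=
    le_of_engine_one hle hnorm
  -- block Gibbs expectations = mixture averages (hubbard-thermal's vocabulary)
  have hmix : ∀ X : Matrix (Finset (Orb (FermionTorus 2 L))) (Finset (Orb (FermionTorus 2 L))) ℂ,
      gibbsState β (H.toBlock p p) (X.toBlock p p) =
        ∑ i, (sectorGibbsWeightTT' β 1 tp U n L i : ℂ) * expect X (sectorGibbsVectorTT' 1 tp U n L i) := by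
    intro X
    rw [sum_sectorGibbsWeightTT'_mul_expect_eq_gibbsState, gibbsState_sectorHamiltonianTT'_eq_toBlock]
  rw [hmix K, hmix, hmix] at hle'
  -- the three expectations are `L²` × torus averages of the local words
  have h1 : Set.InjOn (Torus.proj (d := 2) L) ↑(box 2 1) := injOn_proj_box (by omega)
  have hK : ∀ ψ : Fock (Orb (FermionTorus 2 L)), expect K ψ = ((L : ℂ) ^ 2) * torusAvgExpectAt L (box 2 1) (kinBondObsTT tp) ψ := by
    intro ψ
    rw [hKdef, kinOpTT'_eq_sum_translate L tp h1, expect_sum_relabel_translate_fermionEmbed' L h1]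
  have hD : ∀ ψ : Fock (Orb (FermionTorus 2 L)), expect (Complex.I • (J * Ca - Ca * J)) ψ =
      ((L : ℂ) ^ 2) * (Complex.I * torusAvgExpectAt L (box 2 (r + 2)) dA ψ) := by
    intro ψ
    have h := expect_cur_comm_sum_translate_eq_sq_mul_torusAvg (L := L) tp (r := r) (by omega) hr a ψ
    rw [hJdef, hCadef, hdAdef, Literature.MathematicalPhysics.QuantumLattice.expect, Matrix.smul_mulVec, dotProduct_smul,
      smul_eq_mul, ← Literature.MathematicalPhysics.QuantumLattice.expect, h]
    ring
  have hM : ∀ ψ : Fock (Orb (FermionTorus 2 L)), expect (Ca * (H * Ca - Ca * H) - (H * Ca - Ca * H) * Ca) ψ =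
      ((L : ℂ) ^ 2) * torusAvgExpectAt L (box 2 (3 * r + 2)) mA ψ := by
    intro ψ
    rw [hHdef, hCadef, hmAdef]
    exact expect_sum_translate_doubleComm_eq_sq_mul_torusAvg (L := L) tp U (r := r) (by omega) hr hae ψ
  simp_rw [hK, hD, hM] at hle'
  -- the word as ONE local observable on `[-(3r+2), 3r+2]²`
  have hΩ : Set.InjOn (Torus.proj (d := 2) L) ↑(box 2 (3 * r + 2)) := injOn_proj_box (by omega)
  have hword : ∀ ψ : Fock (Orb (FermionTorus 2 L)),
      torusAvgExpectAt L (box 2 (3 * r + 2))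
          (((1 / 2 : ℝ) : ℂ) • fermionEmbed (PolySite.incl (box_subset_box (by omega) : box 2 1 ⊆ box 2 (3 * r + 2)))
              (kinBondObsTT tp) +
            Complex.I • fermionEmbed (PolySite.incl (box_subset_box (by omega) : box 2 (r + 2) ⊆ box 2 (3 * r + 2))) dA +
            ((1 / 2 : ℝ) : ℂ) • mA) ψ =
        ((1 / 2 : ℝ) : ℂ) * torusAvgExpectAt L (box 2 1) (kinBondObsTT tp) ψ +
          Complex.I * torusAvgExpectAt L (box 2 (r + 2)) dA ψ + ((1 / 2 : ℝ) : ℂ) * torusAvgExpectAt L (box 2 (3 * r + 2)) mA ψ := by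
    intro ψ
    set A : Fin 3 → FermionOp (box 2 (3 * r + 2)) :=
      ![fermionEmbed (PolySite.incl (box_subset_box (by omega) : box 2 1 ⊆ box 2 (3 * r + 2))) (kinBondObsTT tp),
        fermionEmbed (PolySite.incl (box_subset_box (by omega) : box 2 (r + 2) ⊆ box 2 (3 * r + 2))) dA, mA] with hA
    set c : Fin 3 → ℂ := ![((1 / 2 : ℝ) : ℂ), Complex.I, ((1 / 2 : ℝ) : ℂ)] with hc
    have hsum : ((1 / 2 : ℝ) : ℂ) • fermionEmbed (PolySite.incl (box_subset_box (by omega) : box 2 1 ⊆ box 2 (3 * r + 2)))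
          (kinBondObsTT tp) +
        Complex.I • fermionEmbed (PolySite.incl (box_subset_box (by omega) : box 2 (r + 2) ⊆ box 2 (3 * r + 2))) dA +
        ((1 / 2 : ℝ) : ℂ) • mA = ∑ k ∈ Finset.univ, c k • A k := by
      rw [Fin.sum_univ_three, hA, hc]
      simp only [Matrix.cons_val_zero, Matrix.cons_val_one, Matrix.cons_val_two, Matrix.tail_cons, Matrix.head_cons]
    rw [hsum, torusAvgExpectAt_sum_smul, Fin.sum_univ_three, hA, hc]
    simp only [Matrix.cons_val_zero, Matrix.cons_val_one, Matrix.cons_val_two, Matrix.tail_cons, Matrix.head_cons]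
    rw [torusAvgExpectAt_fermionEmbed_incl L _ hΩ, torusAvgExpectAt_fermionEmbed_incl L _ hΩ]
  simp_rw [hword]
  -- collect: everything is `L²` × (real part of a sum); divide by `L²`
  have hre : ∀ (f : Fin (sectorGibbsCount n L) → ℂ),
      (∑ i, (sectorGibbsWeightTT' β 1 tp U n L i : ℂ) * (((L : ℂ) ^ 2) * f i)).re =
        (L : ℝ) ^ 2 * (∑ i, (sectorGibbsWeightTT' β 1 tp U n L i : ℂ) * f i).re := by
    intro f
    rw [show (∑ i, (sectorGibbsWeightTT' β 1 tp U n L i : ℂ) * (((L : ℂ) ^ 2) * f i)) =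
        ((L : ℂ) ^ 2) * ∑ i, (sectorGibbsWeightTT' β 1 tp U n L i : ℂ) * f i by
      rw [Finset.mul_sum]; exact Finset.sum_congr rfl fun i _ => by ring,
      ← Complex.ofReal_natCast, ← Complex.ofReal_pow, Complex.re_ofReal_mul]
  rw [hre, hre, hre] at hle'
  -- split the real part of the mixture average of the word into the three pieces
  have hsplit : (∑ i, (sectorGibbsWeightTT' β 1 tp U n L i : ℂ) *
      (((1 / 2 : ℝ) : ℂ) * torusAvgExpectAt L (box 2 1) (kinBondObsTT tp) (sectorGibbsVectorTT' 1 tp U n L i) +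
        Complex.I * torusAvgExpectAt L (box 2 (r + 2)) dA (sectorGibbsVectorTT' 1 tp U n L i) +
        ((1 / 2 : ℝ) : ℂ) * torusAvgExpectAt L (box 2 (3 * r + 2)) mA (sectorGibbsVectorTT' 1 tp U n L i))).re =
      (1 / 2) * (∑ i, (sectorGibbsWeightTT' β 1 tp U n L i : ℂ) *
          torusAvgExpectAt L (box 2 1) (kinBondObsTT tp) (sectorGibbsVectorTT' 1 tp U n L i)).re +
        (∑ i, (sectorGibbsWeightTT' β 1 tp U n L i : ℂ) *
          (Complex.I * torusAvgExpectAt L (box 2 (r + 2)) dA (sectorGibbsVectorTT' 1 tp U n L i))).re +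
        (1 / 2) * (∑ i, (sectorGibbsWeightTT' β 1 tp U n L i : ℂ) *
          torusAvgExpectAt L (box 2 (3 * r + 2)) mA (sectorGibbsVectorTT' 1 tp U n L i)).re := by
    simp only [mul_add, Finset.sum_add_distrib, Complex.add_re]
    rw [show (∑ i, (sectorGibbsWeightTT' β 1 tp U n L i : ℂ) * (((1 / 2 : ℝ) : ℂ) *
        torusAvgExpectAt L (box 2 1) (kinBondObsTT tp) (sectorGibbsVectorTT' 1 tp U n L i))) =
        ((1 / 2 : ℝ) : ℂ) * ∑ i, (sectorGibbsWeightTT' β 1 tp U n L i : ℂ) *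
          torusAvgExpectAt L (box 2 1) (kinBondObsTT tp) (sectorGibbsVectorTT' 1 tp U n L i) by
      rw [Finset.mul_sum]; exact Finset.sum_congr rfl fun i _ => by ring,
      show (∑ i, (sectorGibbsWeightTT' β 1 tp U n L i : ℂ) * (((1 / 2 : ℝ) : ℂ) *
        torusAvgExpectAt L (box 2 (3 * r + 2)) mA (sectorGibbsVectorTT' 1 tp U n L i))) =
        ((1 / 2 : ℝ) : ℂ) * ∑ i, (sectorGibbsWeightTT' β 1 tp U n L i : ℂ) *
          torusAvgExpectAt L (box 2 (3 * r + 2)) mA (sectorGibbsVectorTT' 1 tp U n L i) by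
      rw [Finset.mul_sum]; exact Finset.sum_congr rfl fun i _ => by ring,
      Complex.re_ofReal_mul, Complex.re_ofReal_mul]
  rw [hsplit]
  -- `ρs L² ≤ L² · (…)` ⇒ `ρs ≤ …`
  exact le_word_of_mul_sq_le hle' hL2

end Mixture

end Summit.Ventures.CertifiedManyBodySolver.Observables
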